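import Summits.AtomisticToContinuum.FouriersLaw.Theorems.BondHeatUncertaintyBoundedResponseStorageLeakHanger
import Summits.AtomisticToContinuum.FouriersLaw.Theorems.BondHeatUncertaintyBoundedResponseEnergyFluctuation
import HarnessLib

/-!
# BondHeatUncertainty / BoundedResponse — «CorrectorCollapse»: (C₁) ⟹ KCB (so KCB ⟺ (C₁)), and (C₁) ⟹ (U)

Decomposition node `decomp-a2c-lens-1 / g99` (grading lens; critic row 1396 (ii)) — the CONVERSE of the KCB hanger
`correctorGrade_one_of_kineticCorrectorBudget` (…StorageLeakHanger, GEN 95E addendum), plus one consequence for DOOR v6.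

* `kineticCorrectorBudget_of_correctorGrade_one : CorrectorGrade 1 → KineticCorrectorBudget` (constant `4C`, same `N₀`):
  `∫_(0,τ] P_uθ₀ du = h₀ − P_τh₀` pointwise and `‖h₀ − P_τh₀‖²_{μ_T} ≤ 4‖h₀‖²_{μ_T}` for EVERY `τ ≥ 0` (tree shift identity +
  `L²(μ_T)`-contraction, packaged as `increment_facts`).  Hence `kineticCorrectorBudget_iff_correctorGrade_one :
  KineticCorrectorBudget ↔ CorrectorGrade 1` — GEN 53K's `τ`-ladder is FLAT: the route item KCB and (C₁) are ONE statement up to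
  the factor `4` ((C₁) is not «the weakest rung of the KCB ladder» but KCB itself).
* `abs_escapeTransient_le_correctorSq` (fixed `N ≥ 1`, every `t ≥ 0`): `|Ov_N(t)| ≤ (2γ/T²)·‖h₀‖²_{μ_T}` — the transient is the
  corrector pairing `(γ/T²)⟨h₀∘Θ, h₀ − P_th₀⟩_{μ_T}` (`escapeTransient_eq_pairing`), `|ab| ≤ a² + b²/4`, flip invariance of `μ_T`,
  and `‖h₀ − P_th₀‖² ≤ 4‖h₀‖²`.  So (C₁) bounds the transient TWO-SIDEDLY and UNIFORMLY IN TIME at the Ohmic scale: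
  `transientCeilingPoint_of_correctorGrade_one : CorrectorGrade 1 → TransientCeilingPoint` ((C₁) ⟹ (U); the floor side
  (C₁) ⟹ `TransientFloor 1` is the tree's `transientFloor_of_grade ∘ oddSnapshotGrade_of_correctorGrade`).
* With the tree's (V) `energyFluctuationExtensive_holds`, `leakPoint_of_boundedResponse` and DOOR v6
  `boundedResponse_of_leakPoint_grades`: `leakPoint_iff_boundedResponse_of_correctorGrade_one :
  CorrectorGrade 1 → (LeakPoint ↔ BoundedResponse)` — (D_F) ≡ 11071 modulo (C₁) ALONE (the tree's `leakPoint_of_boundedResponse`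
  had «modulo {(U), (V), (C₁)}»; (V) is proved and (U) ⟸ (C₁) here); the same with KCB in place of (C₁).

Honest tags: NORMAL-FORM · TRUE (bookkeeping over tree theorems) · helper · OUTSIDE (TW) · no rung.  No `def`, no item closed,
0 sorry, standard axioms.

References: [cite: CuneoEckmannHairerReyBellet2018, Thm 2.13] (Harris package behind `increment_facts`),
[cite: KunduDharNarayan2009] (Green–Kubo for the chain).
-/

noncomputable section

open MeasureTheory ProbabilityTheory Filter Topology Set Function
open scoped NNReal ENNReal
open Literature.MathematicalPhysics.KineticTheory.HeatConduction
open Literature.MathematicalPhysics.KineticTheory OscillatorChain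
open Summit.AtomisticToContinuum.FouriersLaw.Theorems.SubdiffusiveBondHeat
open Summit.AtomisticToContinuum.FouriersLaw.Theorems.OddSectorIrreversibility
open Summit.AtomisticToContinuum.FouriersLaw.Theorems.BoundedResponse.TransientBand
open Summit.AtomisticToContinuum.FouriersLaw.Cruxes.SuperadditiveResistance.FloatingProbeBypassLaplacian (integral_flip_gibbsMeasure)

namespace Summit.AtomisticToContinuum.FouriersLaw.Theorems.BoundedResponse.ParityFloor

open Summit.AtomisticToContinuum.FouriersLaw.Theses.BondHeatUncertainty (BoundedResponse)
open Summit.AtomisticToContinuum.FouriersLaw.Theorems.BoundedResponse.TransientBand (TransientCeilingPoint)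
open Summit.AtomisticToContinuum.FouriersLaw.Theorems.SubdiffusiveBondHeat.CorrectorBudget (KineticCorrectorBudget)

/-! ## §C The collapse KCB ⟺ (C₁) -/

section CorrectorCollapse

variable {ω₂ lam β γ T : ℝ} {N : ℕ}

/-- **(C₁) ⟹ KCB with constant `4C`**: for `N ≥ max N₀ 1` and every `τ ≥ 0`,
`‖∫₀^τ P_uθ₀ du‖²_{μ_T} = ‖h₀ − P_τh₀‖²_{μ_T} ≤ 4‖h₀‖²_{μ_T} ≤ 4C·N` (`increment_facts`); the `N = 0` junk branch is `0 ≤ 0`.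
[formal bookkeeping] -/
theorem kineticCorrectorBudget_of_correctorGrade_one : CorrectorGrade 1 → KineticCorrectorBudget := by
  intro hC ω₂ lam β γ hω hl hβ hγ T hT
  obtain ⟨C, N₀, hCN⟩ := hC ω₂ lam β γ hω hl hβ hγ T hT
  refine ⟨4 * C, N₀, fun N hN₀ τ hτ => ?_⟩
  by_cases hN : 0 < N
  · obtain ⟨-, hDs, -, hle⟩ := increment_facts hω hl.le hβ hγ hN hT ⟨0, hN⟩ hτ
    have h1 := hCN N hN hN₀
    rw [Real.rpow_one] at h1
    have key : ∫ z, (∫ u in Ioc (0 : ℝ) τ, kinAct ω₂ lam β γ T N ⟨0, hN⟩ u z) ^ 2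
        ∂((pinnedChain ω₂ lam β γ).gibbsMeasure N T) ≤ 4 * C * (N : ℝ) := by
      calc ∫ z, (∫ u in Ioc (0 : ℝ) τ, kinAct ω₂ lam β γ T N ⟨0, hN⟩ u z) ^ 2 ∂((pinnedChain ω₂ lam β γ).gibbsMeasure N T)
          = ∫ z, (kinCorrector ω₂ lam β γ T N ⟨0, hN⟩ z - corrAct ω₂ lam β γ T N ⟨0, hN⟩ τ z) ^ 2
              ∂((pinnedChain ω₂ lam β γ).gibbsMeasure N T) := by
            refine integral_congr_ae (Eventually.of_forall fun z => ?_)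
            dsimp only
            rw [hDs z]
        _ ≤ 4 * ∫ z, kinCorrector ω₂ lam β γ T N ⟨0, hN⟩ z ^ 2 ∂((pinnedChain ω₂ lam β γ).gibbsMeasure N T) := hle
        _ ≤ 4 * (C * (N : ℝ)) := by gcongr
        _ = 4 * C * (N : ℝ) := by ring
    rw [dif_pos hN]
    simpa only [kinAct, kinObs, intervalIntegral.integral_of_le hτ] using key
  · rw [dif_neg hN]
    have h0 : N = 0 := by omega
    subst h0
    simp

/-- **KCB ⟺ (C₁)** (`correctorGrade_one_of_kineticCorrectorBudget`, tree, and the converse above): GEN 53K's kinetic-corrector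
budget and the corrector grade `CorrectorGrade 1` are one statement. [formal bookkeeping] -/
theorem kineticCorrectorBudget_iff_correctorGrade_one : KineticCorrectorBudget ↔ CorrectorGrade 1 :=
  ⟨correctorGrade_one_of_kineticCorrectorBudget, kineticCorrectorBudget_of_correctorGrade_one⟩

/-! ## §U The transient is Ohmic under (C₁): `|Ov_N(t)| ≤ (2γ/T²)‖h₀‖²` for every `t ≥ 0` -/

/-- **Two-sided, uniform-in-time bound on the escape transient by the corrector norm**: for `N ≥ 1`, `t ≥ 0`,
`|Ov_N(t)| ≤ (2γ/T²) ∫ h₀² dμ_T` — `Ov_N(t) = (γ/T²)∫ h₀(Θz)(h₀ − P_th₀)(z) dμ_T` (`escapeTransient_eq_pairing`),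
`|ab| ≤ a² + b²/4`, `∫ (h₀∘Θ)² = ∫ h₀²` (`corrector_sq_facts`, flip invariance) and `∫ (h₀ − P_th₀)² ≤ 4∫ h₀²` (`increment_facts`).
[folklore] -/
theorem abs_escapeTransient_le_correctorSq (hω : 0 < ω₂) (hl : 0 < lam) (hβ : 0 < β) (hγ : 0 < γ) (hN : 0 < N)
    (hT : 0 < T) {t : ℝ} (ht : 0 ≤ t) :
    |escapeTransient ω₂ lam β γ T N t| ≤
      2 * γ / T ^ 2 * ∫ z, kinCorrector ω₂ lam β γ T N ⟨0, hN⟩ z ^ 2 ∂((pinnedChain ω₂ lam β γ).gibbsMeasure N T) := by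
  set P := pinnedChain ω₂ lam β γ with hP
  obtain ⟨hDm, -, hD2, hD4⟩ := increment_facts hω hl.le hβ hγ hN hT ⟨0, hN⟩ ht
  obtain ⟨-, h02, h0m', h02'⟩ := corrector_sq_facts hω hl.le hβ hγ hN hT ⟨0, hN⟩
  have ia2 : ∫ z, kinCorrector ω₂ lam β γ T N ⟨0, hN⟩ (z.1, -z.2) ^ 2 ∂(P.gibbsMeasure N T) =
      ∫ z, kinCorrector ω₂ lam β γ T N ⟨0, hN⟩ z ^ 2 ∂(P.gibbsMeasure N T) :=
    integral_flip_gibbsMeasure P N T (fun y => kinCorrector ω₂ lam β γ T N ⟨0, hN⟩ y ^ 2)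
  have iFD := integrable_mul_of_integrable_sq h0m'.aestronglyMeasurable hDm.aestronglyMeasurable h02' hD2
  have h1 : |∫ z, kinCorrector ω₂ lam β γ T N ⟨0, hN⟩ (z.1, -z.2) *
        (kinCorrector ω₂ lam β γ T N ⟨0, hN⟩ z - corrAct ω₂ lam β γ T N ⟨0, hN⟩ t z) ∂(P.gibbsMeasure N T)| ≤
      (∫ z, kinCorrector ω₂ lam β γ T N ⟨0, hN⟩ (z.1, -z.2) ^ 2 ∂(P.gibbsMeasure N T)) +
        (∫ z, (kinCorrector ω₂ lam β γ T N ⟨0, hN⟩ z - corrAct ω₂ lam β γ T N ⟨0, hN⟩ t z) ^ 2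
          ∂(P.gibbsMeasure N T)) / 4 := by
    refine (abs_integral_le_integral_abs).trans ?_
    rw [← integral_div, ← integral_add h02' (hD2.div_const 4)]
    refine integral_mono iFD.abs (h02'.add (hD2.div_const 4)) fun z => ?_
    dsimp only
    rw [abs_mul]
    nlinarith [sq_nonneg (|kinCorrector ω₂ lam β γ T N ⟨0, hN⟩ (z.1, -z.2)| -
      |kinCorrector ω₂ lam β γ T N ⟨0, hN⟩ z - corrAct ω₂ lam β γ T N ⟨0, hN⟩ t z| / 2),
      sq_abs (kinCorrector ω₂ lam β γ T N ⟨0, hN⟩ (z.1, -z.2)),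
      sq_abs (kinCorrector ω₂ lam β γ T N ⟨0, hN⟩ z - corrAct ω₂ lam β γ T N ⟨0, hN⟩ t z)]
  have hg : (0 : ℝ) < γ / T ^ 2 := by positivity
  rw [escapeTransient_eq_pairing hω hl hβ hγ hN hT ht, abs_mul, abs_of_pos hg]
  calc γ / T ^ 2 * |∫ z, kinCorrector ω₂ lam β γ T N ⟨0, hN⟩ (z.1, -z.2) *
          (kinCorrector ω₂ lam β γ T N ⟨0, hN⟩ z - corrAct ω₂ lam β γ T N ⟨0, hN⟩ t z) ∂(P.gibbsMeasure N T)|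
      ≤ γ / T ^ 2 * ((∫ z, kinCorrector ω₂ lam β γ T N ⟨0, hN⟩ (z.1, -z.2) ^ 2 ∂(P.gibbsMeasure N T)) +
          (∫ z, (kinCorrector ω₂ lam β γ T N ⟨0, hN⟩ z - corrAct ω₂ lam β γ T N ⟨0, hN⟩ t z) ^ 2
            ∂(P.gibbsMeasure N T)) / 4) := by gcongr
    _ ≤ γ / T ^ 2 * ((∫ z, kinCorrector ω₂ lam β γ T N ⟨0, hN⟩ z ^ 2 ∂(P.gibbsMeasure N T)) +
          (4 * ∫ z, kinCorrector ω₂ lam β γ T N ⟨0, hN⟩ z ^ 2 ∂(P.gibbsMeasure N T)) / 4) := by rw [ia2]; gcongr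
    _ = _ := by ring

/-- **(C₁) ⟹ (U) `TransientCeilingPoint`** (indeed at EVERY window constant; here `c = 1`): `Ov_N(N²) ≤ |Ov_N(N²)| ≤ (2γ/T²)C·N`
for `N ≥ max N₀ 1`. [formal bookkeeping] -/
theorem transientCeilingPoint_of_correctorGrade_one : CorrectorGrade 1 → TransientCeilingPoint := by
  intro hC ω₂ lam β γ hω hl hβ hγ T hT
  obtain ⟨C, N₀, hCN⟩ := hC ω₂ lam β γ hω hl hβ hγ T hT
  refine ⟨2 * γ / T ^ 2 * C, 1, one_pos, max N₀ 1, fun N hN => ?_⟩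
  have hN₀ : N₀ ≤ N := le_trans (le_max_left _ _) hN
  have hN0 : 0 < N := lt_of_lt_of_le Nat.one_pos (le_trans (le_max_right _ _) hN)
  have h1 := hCN N hN0 hN₀
  rw [Real.rpow_one] at h1
  have ht : (0 : ℝ) ≤ 1 * (N : ℝ) ^ 2 := by positivity
  have hg : (0 : ℝ) ≤ 2 * γ / T ^ 2 := by positivity
  calc escapeTransient ω₂ lam β γ T N (1 * (N : ℝ) ^ 2) ≤ |escapeTransient ω₂ lam β γ T N (1 * (N : ℝ) ^ 2)| := le_abs_self _
    _ ≤ 2 * γ / T ^ 2 * ∫ z, kinCorrector ω₂ lam β γ T N ⟨0, hN0⟩ z ^ 2 ∂((pinnedChain ω₂ lam β γ).gibbsMeasure N T) :=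
        abs_escapeTransient_le_correctorSq hω hl hβ hγ hN0 hT ht
    _ ≤ 2 * γ / T ^ 2 * (C * (N : ℝ)) := mul_le_mul_of_nonneg_left h1 hg
    _ = _ := by ring

/-! ## §D DOOR v6 in normal form: given (C₁) (equivalently KCB), (D_F) `LeakPoint` ⟺ 11071 `BoundedResponse` -/

/-- **11071 ∧ (C₁) ⟹ (D_F)**: `leakPoint_of_boundedResponse` (tree) with (U) from `transientCeilingPoint_of_correctorGrade_one` and
(V) from the tree's `energyFluctuationExtensive_holds`. [formal bookkeeping] -/
theorem leakPoint_of_boundedResponse_correctorGrade_one : BoundedResponse → CorrectorGrade 1 → LeakPoint := fun hB hC =>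
  leakPoint_of_boundedResponse hB (transientCeilingPoint_of_correctorGrade_one hC) energyFluctuationExtensive_holds hC

/-- **DOOR v6, normal form**: under (C₁) alone, (D_F) `LeakPoint` ⟺ `BoundedResponse` (stmt-11071)
(`boundedResponse_of_leakPoint_grades` with (V) proved; `leakPoint_of_boundedResponse_correctorGrade_one`). [formal bookkeeping] -/
theorem leakPoint_iff_boundedResponse_of_correctorGrade_one (hC : CorrectorGrade 1) : LeakPoint ↔ BoundedResponse :=
  ⟨fun hF => boundedResponse_of_leakPoint_grades hF energyFluctuationExtensive_holds hC,
    fun hB => leakPoint_of_boundedResponse_correctorGrade_one hB hC⟩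

/-- **The same on the KCB item**: under `KineticCorrectorBudget`, `LeakPoint ↔ BoundedResponse`. [formal bookkeeping] -/
theorem leakPoint_iff_boundedResponse_of_kcb (hK : KineticCorrectorBudget) : LeakPoint ↔ BoundedResponse :=
  leakPoint_iff_boundedResponse_of_correctorGrade_one (correctorGrade_one_of_kineticCorrectorBudget hK)

/-- **DOOR v6 on two legs**: `BoundedResponse ⟸ LeakPoint ∧ CorrectorGrade 1` ((V) discharged by name). [formal bookkeeping] -/
theorem boundedResponse_of_leakPoint_correctorGrade_one : LeakPoint → CorrectorGrade 1 → BoundedResponse := fun hF hC =>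
  boundedResponse_of_leakPoint_grades hF energyFluctuationExtensive_holds hC

end CorrectorCollapse

end Summit.AtomisticToContinuum.FouriersLaw.Theorems.BoundedResponse.ParityFloor

end
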